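import Literature.Computability.AlgebraicComplexity.AlperBogartVelascoProofs
import Summits.ValiantsHypothesis.ValiantsHypothesis.Theses.SymPencil

/-!
# Route `SymPencil`, item `SdcPerThreeTen` (stmt-ValiantsHypothesis-5681):
# `per_3` has no symmetric affine determinantal representation of size `≤ 12`

We prove the route's support statement `SdcPerThreeTen` (`10 ≤ m` for every symmetric affine
determinantal representation of `per_3` of size `m` over `ℂ`) in the stronger form **`13 ≤ m`**,
over any field with `2 ≠ 0`, by the SYMMETRIC analogue of Alper–Bogart–Velasco's Thm. 1.2
(J. Alper, T. Bogart, M. Velasco, Found. Comput. Math. 17 (2017), proof of Thm. 1.2 — in the tree as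
`AlperBogartVelasco.exists_subspace_of_isAffineDetRepr_perPoly`):

* von zur Gathen's regularity (`AlperBogartVelasco.le_rank_map_eval_add_one`, proved in the tree)
  gives `rank A(0) = m - 1` for `det A = per_n`, `n ≥ 3`;
* **symmetric normal form** (`exists_transpose_mul_mul_eq_diagonal`): `A(0)` is symmetric, so
  `Pᵀ A(0) P = diag(d)` for an invertible CONSTANT `P` (orthogonal basis, `2 ≠ 0`), with exactly
  one `d_{i₀} = 0`; rescaling the rows by `e = (1 at i₀, d⁻¹ elsewhere)` gives
  `B := diag(e) Pᵀ · A · P` with constant part `Λ_{i₀}` and `det B = c · per_n`, `c ≠ 0` — and,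
  because `Pᵀ A P` is still symmetric, the column `i₀` of every coefficient matrix of `B` is the
  row `i₀` rescaled: `Z_{j i₀} = e_j Z_{i₀ j}` (`hscale`);
* the low-order identities of ABV (`constantCoeff_pderiv_det`, `constantCoeff_pderiv_pderiv_det`,
  homogeneity of `per_n` of degree `n > 2`) give `Z_{i₀ i₀} = 0` and, after `hscale`,
  `Σ_s e_s Z_{i₀ s}(x) Z_{i₀ s}(y) = 0`: the image of `G : x ↦ Z_{i₀ ·}(x)` is a totally isotropic
  subspace of the NON-DEGENERATE DIAGONAL form `Σ_s e_s z_s z'_s` inside `{z_{i₀} = 0}`, hence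
  (`two_mul_finrank_add_one_le_card_of_isotropic`) `2 · dim im G + 1 ≤ m` — twice the bound that
  the split quadric gives in the non-symmetric case;
* all partials of `per_n` vanish on `W := ker G` (`eval_pderiv_det_eq_zero`), and
  `codim W = dim im G`, so `2 n² + 1 ≤ 2 dim W + m`
  (`exists_subspace_of_isSymm_isAffineDetRepr_perPoly`);
* for `n = 3`, `dim W ≤ 3` (`finrank_le_three_of_subperm_two_vanish`), so `13 ≤ m`
  (`thirteen_le_of_isSymm_isAffineDetRepr_perPoly_three`).  (For `n = 4`, `dim W ≤ 8` gives
  `17 ≤ m`, the `n = 4` instance of the route's crux `SdcPerBeyondN`; filed separately.)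

The closing theorem is `sdcPerThreeTen_proof : SdcPerThreeTen` (`10 ≤ 13 ≤ m`).
-/

noncomputable section

-- single-conjunct layout: Sub = Summit, duplicated namespace component intended
set_option linter.dupNamespace false

namespace Summit.ValiantsHypothesis.ValiantsHypothesis.Theorems.SymPencilSdcPerThreeTen

open Matrix MvPolynomial Finset Module
open Literature.Computability.AlgebraicComplexity
open Literature.Computability.AlgebraicComplexity.AlperBogartVelasco
open Literature.Computability.AlgebraicComplexity.LRPencil

/-! ### Symmetric normal form of the constant part -/

/-- **Congruence diagonalisation of a symmetric matrix** over a field with `2` invertible: there is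
an invertible `P` with `Pᵀ M P` diagonal (the Gram matrix of an orthogonal basis of the symmetric
bilinear form `x ⬝ M y`, Mathlib's `LinearMap.BilinForm.exists_orthogonal_basis`). -/
theorem exists_transpose_mul_mul_eq_diagonal {K : Type*} [Field K] [Invertible (2 : K)]
    {ι : Type*} [Fintype ι] [DecidableEq ι] (M : Matrix ι ι K) (hM : M.IsSymm) :
    ∃ (P : Matrix ι ι K) (d : ι → K), IsUnit P ∧ Pᵀ * M * P = Matrix.diagonal d := by
  set B : LinearMap.BilinForm K (ι → K) := Matrix.toBilin' M with hBdef
  have hB : B.IsSymm := Matrix.isSymm_toBilin'_iff_isSymm.2 hM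
  obtain ⟨v, hv⟩ := LinearMap.BilinForm.exists_orthogonal_basis (LinearMap.BilinForm.isSymm_iff.1 hB)
  let e : Fin (finrank K (ι → K)) ≃ ι :=
    (finCongr (finrank_fintype_fun_eq_card K)).trans (Fintype.equivFin ι).symm
  let w : Basis ι K (ι → K) := v.reindex e
  have hw : ∀ i j, i ≠ j → B (w i) (w j) = 0 := by
    intro i j hij
    rw [Basis.reindex_apply, Basis.reindex_apply]
    exact LinearMap.isOrthoᵢ_def.1 hv _ _ fun h => hij (e.symm.injective h)
  let b : Basis ι K (ι → K) := Pi.basisFun K ι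
  refine ⟨b.toMatrix w, fun i => B (w i) (w i), ?_, ?_⟩
  · haveI := b.invertibleToMatrix w
    exact isUnit_of_invertible _
  · have hbM : LinearMap.BilinForm.toMatrix b B = M := by
      rw [LinearMap.BilinForm.toMatrix_basisFun, hBdef, LinearMap.BilinForm.toMatrix'_toBilin']
    have h := LinearMap.BilinForm.toMatrix_mul_basis_toMatrix (b := b) w B
    rw [hbM] at h
    rw [h]
    ext i j
    rw [LinearMap.BilinForm.toMatrix_apply, Matrix.diagonal_apply]
    split_ifs with hij
    · rw [hij]
    · exact hw i j hij

/-- **Normal form `Λ_{i₀}` by congruence-and-row-scaling**: a symmetric matrix `Λ` of rank `|ι| - 1`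
over a field with `2` invertible admits an invertible `P` and nonzero row weights `e` with
`(diag e · Pᵀ) Λ P = Λ_{i₀}` and `e i₀ = 1` — so that `diag e · Pᵀ · S · P` has column `i₀` equal to
`e`-times its row `i₀` whenever `S` is symmetric. -/
theorem exists_congr_normalForm {K : Type*} [Field K] [Invertible (2 : K)]
    {ι : Type*} [Fintype ι] [DecidableEq ι] (Λ : Matrix ι ι K) (hΛ : Λ.IsSymm)
    (hrank : Λ.rank = Fintype.card ι - 1) (hι : 0 < Fintype.card ι) :
    ∃ (P : Matrix ι ι K) (e : ι → K) (i₀ : ι), IsUnit P ∧ (∀ i, e i ≠ 0) ∧ e i₀ = 1 ∧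
      Matrix.diagonal e * Pᵀ * Λ * P = lamMatrix K i₀ := by
  classical
  obtain ⟨P, d, hP, hPd⟩ := exists_transpose_mul_mul_eq_diagonal Λ hΛ
  have hPdet : IsUnit P.det := (Matrix.isUnit_iff_isUnit_det P).1 hP
  have hPtdet : IsUnit Pᵀ.det := by rwa [Matrix.det_transpose]
  -- the diagonal form has rank `|ι| - 1`: exactly one zero weight
  have hrd : Fintype.card {i // d i ≠ 0} = Fintype.card ι - 1 := by
    rw [← Matrix.rank_diagonal, ← hPd, Matrix.mul_assoc, Matrix.rank_mul_eq_right_of_isUnit_det _ _ hPtdet,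
      Matrix.rank_mul_eq_left_of_isUnit_det _ _ hPdet, hrank]
  have hz : Fintype.card {i // d i = 0} = 1 := by
    have h := Fintype.card_subtype_compl (fun i => d i ≠ 0)
    have h' : Fintype.card {i // ¬ d i ≠ 0} = Fintype.card {i // d i = 0} :=
      Fintype.card_congr (Equiv.subtypeEquivRight fun i => by simp)
    rw [← h', h, hrd]
    omega
  obtain ⟨⟨i₀, hi₀⟩, huniq⟩ := Fintype.card_eq_one_iff.1 hz
  have hd : ∀ i, i ≠ i₀ → d i ≠ 0 := fun i hi hdi =>
    hi (congr_arg Subtype.val (huniq ⟨i, hdi⟩))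
  let e : ι → K := fun i => if i = i₀ then 1 else (d i)⁻¹
  refine ⟨P, e, i₀, hP, fun i => ?_, by simp [e], ?_⟩
  · by_cases hi : i = i₀
    · simp [e, hi]
    · simp [e, hi, hd i hi]
  · rw [Matrix.mul_assoc (Matrix.diagonal e), Matrix.mul_assoc (Matrix.diagonal e), hPd,
      Matrix.diagonal_mul_diagonal]
    ext i j
    rw [Matrix.diagonal_apply, lamMatrix_apply]
    by_cases hij : i = j
    · subst hij
      by_cases hi : i = i₀
      · simp [e, hi, hi₀]
      · simp [e, hi, hd i hi]
    · simp [hij]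

/-! ### Isotropic subspaces of a non-degenerate diagonal form -/

/-- **Totally isotropic subspaces of a non-degenerate diagonal form inside a coordinate hyperplane**:
if `Σ_s e_s z_s z'_s = 0` for all `z, z'` in a subspace `T ⊆ K^ι` (all `e_s ≠ 0`) and `z_{i₀} = 0`
on `T`, then `2 · dim T + 1 ≤ |ι|` (`T ⊕ K e_{i₀} ⊆ T^⊥`, of dimension `|ι| - dim T`).  This is the
symmetric counterpart of `AlperBogartVelasco.finrank_add_one_le_card_of_isotropic` (split quadric,
`dim T + 1 ≤ |ι|`), and the source of the factor `2`. -/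
theorem two_mul_finrank_add_one_le_card_of_isotropic {K : Type*} [Field K]
    {ι : Type*} [Fintype ι] [DecidableEq ι] (e : ι → K) (he : ∀ i, e i ≠ 0)
    (T : Submodule K (ι → K)) (i₀ : ι)
    (hT : ∀ z ∈ T, ∀ z' ∈ T, ∑ s, e s * z s * z' s = 0) (h0 : ∀ z ∈ T, z i₀ = 0) :
    2 * finrank K T + 1 ≤ Fintype.card ι := by
  let B : LinearMap.BilinForm K (ι → K) :=
    LinearMap.mk₂ K (fun z z' => ∑ s, e s * z s * z' s)
      (fun z₁ z₂ z' => by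
        simp only [Pi.add_apply, ← Finset.sum_add_distrib]
        exact Finset.sum_congr rfl fun s _ => by ring)
      (fun c z z' => by
        simp only [Pi.smul_apply, smul_eq_mul, Finset.mul_sum]
        exact Finset.sum_congr rfl fun s _ => by ring)
      (fun z z₁ z₂ => by
        simp only [Pi.add_apply, ← Finset.sum_add_distrib]
        exact Finset.sum_congr rfl fun s _ => by ring)
      (fun c z z' => by
        simp only [Pi.smul_apply, smul_eq_mul, Finset.mul_sum]
        exact Finset.sum_congr rfl fun s _ => by ring)
  have hB : ∀ z z', B z z' = ∑ s, e s * z s * z' s := fun _ _ => rfl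
  have hsingle : ∀ (z : ι → K) (i : ι), B z (Pi.single i 1) = e i * z i := by
    intro z i
    rw [hB, Finset.sum_eq_single i]
    · simp
    · intro s _ hs
      simp [hs]
    · simp
  have hsymm : ∀ z z', B z z' = B z' z := fun z z' => by
    rw [hB, hB]
    exact Finset.sum_congr rfl fun s _ => by ring
  have key : ∀ z : ι → K, (∀ z', B z z' = 0) → z = 0 := by
    intro z hz
    funext i
    have h := hz (Pi.single i 1)
    rw [hsingle] at h
    exact (mul_eq_zero.1 h).resolve_left (he i)
  have hnd : B.Nondegenerate :=
    ⟨fun z hz => key z hz, fun z hz => key z fun z' => by rw [hsymm]; exact hz z'⟩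
  let v : ι → K := Pi.single i₀ 1
  have hvT : v ∉ T := fun h => by simpa [v] using h0 v h
  have hle : T ⊔ K ∙ v ≤ B.orthogonal T := by
    refine sup_le (fun z hz => ?_) ?_
    · rw [LinearMap.BilinForm.mem_orthogonal_iff]
      intro z' hz'
      exact hT z' hz' z hz
    · rw [Submodule.span_singleton_le_iff_mem, LinearMap.BilinForm.mem_orthogonal_iff]
      intro z' hz'
      show B z' v = 0
      rw [hsingle, h0 z' hz', mul_zero]
  have h1 := Submodule.finrank_mono hle
  rw [LinearMap.BilinForm.finrank_orthogonal hnd T, finrank_fintype_fun_eq_card] at h1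
  have hne : v ≠ 0 := fun h => by
    have := congr_fun h i₀
    simp [v] at this
  have hdisj : T ⊓ (K ∙ v) = ⊥ := disjoint_iff.1 ((Submodule.disjoint_span_singleton' hne).2 hvT)
  have hsum := Submodule.finrank_sup_add_finrank_inf_eq T (K ∙ v)
  rw [hdisj, finrank_bot, add_zero, finrank_span_singleton hne] at hsum
  have h2 : finrank K T ≤ finrank K (ι → K) := Submodule.finrank_le T
  rw [finrank_fintype_fun_eq_card] at h2
  omega

/-! ### The symmetric Alper–Bogart–Velasco theorem for the permanent -/

/-- **Symmetric ABV, Thm. 1.2, for `f = per_m` (`m ≥ 3`, `2 ≠ 0` in `K`)**: a SYMMETRIC affine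
determinantal representation `A` of `per_m` of size `n` yields a linear subspace `W ⊆ K^{m × m}` on
which all the partials `∂ per_m/∂x_{rc}` vanish and whose codimension is at most `(n - 1)/2`:
`2 m² + 1 ≤ 2 dim W + n`.  Compared with `AlperBogartVelasco.exists_subspace_of_isAffineDetRepr_perPoly`
(`m² + 1 ≤ dim W + n`), the normal form is reached by a congruence `P ↦ diag(e) Pᵀ A P`, which keeps
the column `i₀` of the linear part tied to its row `i₀` (`Z_{j i₀} = e_j Z_{i₀ j}`), so that ABV's
isotropy `Σ_j Z_{i₀ j} Z_{j i₀} = 0` becomes total isotropy of `im G` for the non-degenerate diagonal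
form `Σ_j e_j z_j z'_j` inside `{z_{i₀} = 0}`, of dimension `≤ (n - 1)/2`. -/
theorem exists_subspace_of_isSymm_isAffineDetRepr_perPoly {K : Type*} [Field K] (h2 : (2 : K) ≠ 0)
    {m : ℕ} (hm : 3 ≤ m) {n : ℕ} {A : Matrix (Fin n) (Fin n) (MvPolynomial (Fin m × Fin m) K)}
    (hS : A.IsSymm) (hA : IsAffineDetRepr (perPoly (Fin m) K) A) :
    ∃ W : Submodule K (Fin m × Fin m → K), 2 * (m * m) + 1 ≤ 2 * finrank K W + n ∧
      ∀ x ∈ W, ∀ rc : Fin m × Fin m,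
        MvPolynomial.eval x (pderiv rc (perPoly (Fin m) K)) = 0 := by
  haveI : Invertible (2 : K) := invertibleOfNonzero h2
  obtain ⟨hdeg, hdet⟩ := hA
  -- `n ≥ 1`
  have hn : 0 < n := by
    refine Nat.pos_of_ne_zero fun h => ?_
    subst h
    have h0 := constantCoeff_perPoly K (show 1 ≤ m by omega)
    rw [← hdet, Matrix.det_isEmpty, map_one] at h0
    exact one_ne_zero h0
  -- ABV Prop. 2.1 (von zur Gathen's regularity): the constant part has rank exactly `n - 1`
  have hrank : (constPart A).rank = Fintype.card (Fin n) - 1 := by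
    have hge : n ≤ (constPart A).rank + 1 := by
      rw [constPart_eq_map_eval_zero]
      exact le_rank_map_eval_add_one h2 hm A hdet 0
    have hdet0 : (constPart A).det = 0 := by
      rw [det_constPart, hdet, constantCoeff_perPoly K (by omega)]
    have hlt := Matrix.rank_lt_card_of_det_eq_zero hdet0
    rw [Fintype.card_fin] at hlt ⊢
    omega
  -- the constant part is symmetric: symmetric normal form `(diag e · Pᵀ) A(0) P = Λ_{i₀}`
  have hsym0 : (constPart A).IsSymm := Matrix.IsSymm.ext fun i j => by
    rw [constPart_apply, constPart_apply, hS.apply i j]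
  obtain ⟨P, e, i₀, hP, he, hei₀, hnf⟩ :=
    exists_congr_normalForm (constPart A) hsym0 hrank (by rw [Fintype.card_fin]; exact hn)
  set V : Matrix (Fin n) (Fin n) K := Matrix.diagonal e * Pᵀ with hV
  have hVU : V * constPart A * P = lamMatrix K i₀ := by rw [hV]; exact hnf
  set B : Matrix (Fin n) (Fin n) (MvPolynomial (Fin m × Fin m) K) := V.map C * A * P.map C
    with hB
  have hB0 : constPart B = lamMatrix K i₀ := by
    rw [hB, constPart_mul, constPart_mul, constPart_map_C, constPart_map_C, hVU]
  have hB1 : ∀ r j, (B r j).totalDegree ≤ 1 := by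
    intro r j
    rw [hB, Matrix.mul_apply]
    refine totalDegree_finsetSum_le fun l _ => ?_
    rw [Matrix.mul_apply, Matrix.map_apply]
    refine (totalDegree_mul _ _).trans ?_
    rw [totalDegree_C, add_zero]
    refine totalDegree_finsetSum_le fun k _ => ?_
    rw [Matrix.map_apply]
    refine (totalDegree_mul _ _).trans ?_
    rw [totalDegree_C, zero_add]
    exact hdeg k l
  -- `det B = c · perm_m`, `c ≠ 0`
  have hPdet : P.det ≠ 0 := ((Matrix.isUnit_iff_isUnit_det P).1 hP).ne_zero
  have hVdet : V.det ≠ 0 := by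
    rw [hV, Matrix.det_mul, Matrix.det_diagonal, Matrix.det_transpose]
    exact mul_ne_zero (Finset.prod_ne_zero_iff.2 fun i _ => he i) hPdet
  set c : K := V.det * P.det with hc
  have hc0 : c ≠ 0 := mul_ne_zero hVdet hPdet
  have hdetB : B.det = C c * perPoly (Fin m) K := by
    have hVd : (V.map (C : K →+* MvPolynomial (Fin m × Fin m) K)).det = C V.det := by
      rw [← RingHom.mapMatrix_apply, ← RingHom.map_det]
    have hUd : (P.map (C : K →+* MvPolynomial (Fin m × Fin m) K)).det = C P.det := by
      rw [← RingHom.mapMatrix_apply, ← RingHom.map_det]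
    rw [hB, Matrix.det_mul, Matrix.det_mul, hdet, hVd, hUd, hc, map_mul]
    ring
  -- homogeneity of `perm_m` (degree `m ≥ 3`): its first and second partials have no constant term
  have hhom := perPoly_isHomogeneous (n := Fin m) (k := K)
  have hcc1 : ∀ a, constantCoeff (pderiv a (perPoly (Fin m) K)) = 0 := fun a =>
    constantCoeff_eq_zero_of_isHomogeneous hhom.pderiv (by rw [Fintype.card_fin]; omega)
  have hcc2 : ∀ a b, constantCoeff (pderiv b (pderiv a (perPoly (Fin m) K))) = 0 := fun a b =>
    constantCoeff_eq_zero_of_isHomogeneous hhom.pderiv.pderiv (by rw [Fintype.card_fin]; omega)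
  -- (ABV) `Z_{i₀ i₀} = 0`
  have h00 : ∀ a, coeffMat B a i₀ i₀ = 0 := by
    intro a
    rw [← constantCoeff_pderiv_det hB1 hB0 a, hdetB, pderiv_C_mul, map_mul, constantCoeff_C,
      hcc1, mul_zero]
  -- (ABV) `Σ_j Z_{i₀ j} Z_{j i₀} = 0`, polarised
  have hquad : ∀ a b, ∑ s, (coeffMat B a i₀ s * coeffMat B b s i₀ +
      coeffMat B b i₀ s * coeffMat B a s i₀) = 0 := by
    intro a b
    have h := constantCoeff_pderiv_pderiv_det hB1 hB0 h00 a b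
    rw [hdetB, pderiv_C_mul, pderiv_C_mul, map_mul, constantCoeff_C, hcc2, mul_zero] at h
    exact neg_eq_zero.1 h.symm
  -- SYMMETRY: the column `i₀` of each coefficient matrix is `e`-times its row `i₀`
  have hcoeffA : ∀ w, (coeffMat A w)ᵀ = coeffMat A w := fun w => by
    ext i j
    rw [Matrix.transpose_apply, coeffMat_apply, coeffMat_apply, hS.apply i j]
  have hcoeffB : ∀ w, coeffMat B w = Matrix.diagonal e * (Pᵀ * coeffMat A w * P) := fun w => by
    rw [hB, coeffMat_C_mul_mul_C, hV]
    simp only [Matrix.mul_assoc]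
  have hTsymm : ∀ w i j, (Pᵀ * coeffMat A w * P) j i = (Pᵀ * coeffMat A w * P) i j := by
    intro w i j
    have h : (Pᵀ * coeffMat A w * P)ᵀ = Pᵀ * coeffMat A w * P := by
      rw [Matrix.transpose_mul, Matrix.transpose_mul, Matrix.transpose_transpose, hcoeffA,
        Matrix.mul_assoc]
    have h' := congr_fun (congr_fun h i) j
    rwa [Matrix.transpose_apply] at h'
  have hscale : ∀ w j, coeffMat B w j i₀ = e j * coeffMat B w i₀ j := fun w j => by
    rw [hcoeffB, Matrix.diagonal_mul, Matrix.diagonal_mul, hei₀, one_mul, hTsymm w i₀ j]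
  -- hence total isotropy for the diagonal form `Σ_s e_s z_s z'_s`
  have hquad' : ∀ a b, ∑ s, e s * coeffMat B a i₀ s * coeffMat B b i₀ s = 0 := by
    intro a b
    have h := hquad a b
    simp_rw [hscale] at h
    have h' : ∑ s, (coeffMat B a i₀ s * (e s * coeffMat B b i₀ s) +
        coeffMat B b i₀ s * (e s * coeffMat B a i₀ s)) =
        2 * ∑ s, e s * coeffMat B a i₀ s * coeffMat B b i₀ s := by
      rw [Finset.mul_sum]
      exact Finset.sum_congr rfl fun s _ => by ring
    rw [h'] at h
    exact (mul_eq_zero.1 h).resolve_left h2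
  -- ABV's linear map `G = (Z_{i₀ j})_j` (the row suffices) and `V(I) = ker G`
  let G : (Fin m × Fin m → K) →ₗ[K] (Fin n → K) :=
    { toFun := fun x j => ∑ w, x w * coeffMat B w i₀ j
      map_add' := fun x y => by
        ext j
        simp [add_mul, Finset.sum_add_distrib]
      map_smul' := fun r x => by
        ext j
        simp [Finset.mul_sum, mul_assoc] }
  have hG : ∀ x j, G x j = ∑ w, x w * coeffMat B w i₀ j := fun _ _ => rfl
  have hN : ∀ (x : Fin m × Fin m → K) (i j : Fin n),
      (∑ w, x w • coeffMat B w) i j = ∑ w, x w * coeffMat B w i j := by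
    intro x i j
    simp [Matrix.sum_apply]
  refine ⟨LinearMap.ker G, ?_, ?_⟩
  · -- `2 · codim V(I) + 1 = 2 · dim im G + 1 ≤ n`
    have hiso : ∀ z ∈ LinearMap.range G, ∀ z' ∈ LinearMap.range G,
        ∑ s, e s * z s * z' s = 0 := by
      rintro _ ⟨x, rfl⟩ _ ⟨x', rfl⟩
      show ∑ s, e s * (∑ w, x w * coeffMat B w i₀ s) * (∑ w', x' w' * coeffMat B w' i₀ s) = 0
      calc ∑ s, e s * (∑ w, x w * coeffMat B w i₀ s) * (∑ w', x' w' * coeffMat B w' i₀ s)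
          = ∑ s, ∑ w, ∑ w', e s * (x w * coeffMat B w i₀ s) * (x' w' * coeffMat B w' i₀ s) := by
            refine Finset.sum_congr rfl fun s _ => ?_
            simp only [Finset.mul_sum, Finset.sum_mul]
            exact Finset.sum_comm
        _ = ∑ w, ∑ w', ∑ s, e s * (x w * coeffMat B w i₀ s) * (x' w' * coeffMat B w' i₀ s) := by
            rw [Finset.sum_comm]
            refine Finset.sum_congr rfl fun w _ => ?_
            rw [Finset.sum_comm]
        _ = ∑ w, ∑ w', x w * x' w' * ∑ s, e s * coeffMat B w i₀ s * coeffMat B w' i₀ s := by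
            refine Finset.sum_congr rfl fun w _ => Finset.sum_congr rfl fun w' _ => ?_
            rw [Finset.mul_sum]
            refine Finset.sum_congr rfl fun s _ => ?_
            ring
        _ = 0 := Finset.sum_eq_zero fun w _ => Finset.sum_eq_zero fun w' _ => by
            rw [hquad' w w', mul_zero]
    have h0' : ∀ z ∈ LinearMap.range G, z i₀ = 0 := by
      rintro _ ⟨x, rfl⟩
      show ∑ w, x w * coeffMat B w i₀ i₀ = 0
      exact Finset.sum_eq_zero fun w _ => by rw [h00 w, mul_zero]
    have hrange := two_mul_finrank_add_one_le_card_of_isotropic e he _ i₀ hiso h0'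
    have hrn := LinearMap.finrank_range_add_finrank_ker G
    rw [finrank_fintype_fun_eq_card, Fintype.card_prod, Fintype.card_fin] at hrn
    rw [Fintype.card_fin] at hrange
    generalize m * m = N at hrn ⊢
    omega
  · -- `V(I) ⊆ Sing(perm_m)`: all partials vanish on `ker G`
    intro x hx rc
    have hx' : G x = 0 := LinearMap.mem_ker.1 hx
    have hrow : ∀ j, (∑ w, x w • coeffMat B w) i₀ j = 0 := fun j => by
      rw [hN]
      exact congr_fun hx' j
    have hcol : ∀ j, (∑ w, x w • coeffMat B w) j i₀ = 0 := fun j => by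
      rw [hN]
      simp_rw [hscale _ j]
      have h : ∑ w, x w * (e j * coeffMat B w i₀ j) = e j * ∑ w, x w * coeffMat B w i₀ j := by
        rw [Finset.mul_sum]
        exact Finset.sum_congr rfl fun w _ => by ring
      rw [h, ← hG, hx', Pi.zero_apply, mul_zero]
    have h := eval_pderiv_det_eq_zero hB1 hB0 rc (h00 rc) x hrow hcol
    rw [hdetB, pderiv_C_mul, map_mul, eval_C] at h
    exact (mul_eq_zero.1 h).resolve_left hc0

/-! ### `sdc(per_3) ≥ 13` and the item -/

/-- **`sdc(per_3) ≥ 13`** over any field with `2 ≠ 0`: a symmetric affine determinantal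
representation of `per_3` of size `n` gives `W` with `19 ≤ 2 dim W + n` and `dim W ≤ 3`
(`finrank_le_three_of_subperm_two_vanish`). -/
theorem thirteen_le_of_isSymm_isAffineDetRepr_perPoly_three (K : Type*) [Field K]
    (h2 : (2 : K) ≠ 0) {n : ℕ} {A : Matrix (Fin n) (Fin n) (MvPolynomial (Fin 3 × Fin 3) K)}
    (hS : A.IsSymm) (hA : IsAffineDetRepr (perPoly (Fin 3) K) A) : 13 ≤ n := by
  obtain ⟨W, hW, hvan⟩ := exists_subspace_of_isSymm_isAffineDetRepr_perPoly h2 le_rfl hS hA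
  have hfin : finrank K W ≤ 3 :=
    finrank_le_three_of_subperm_two_vanish W fun x hx r c => by
      rw [← eval_pderiv_perPoly_eq_permanent_submatrix]
      exact hvan x hx (r, c)
  omega

/-- **Item `SdcPerThreeTen` (stmt-ValiantsHypothesis-5681) — PROVED**: `per_3` has no symmetric
affine determinantal representation of size `≤ 9` over `ℂ`; indeed none of size `≤ 12`
(`thirteen_le_of_isSymm_isAffineDetRepr_perPoly_three` with `2 ≠ 0` in `ℂ`). -/
theorem sdcPerThreeTen_proof :
    Summit.ValiantsHypothesis.ValiantsHypothesis.Theses.SymPencil.SdcPerThreeTen := by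
  unfold Summit.ValiantsHypothesis.ValiantsHypothesis.Theses.SymPencil.SdcPerThreeTen
  intro m A hS hA
  have h := thirteen_le_of_isSymm_isAffineDetRepr_perPoly_three ℂ two_ne_zero hS hA
  omega

end Summit.ValiantsHypothesis.ValiantsHypothesis.Theorems.SymPencilSdcPerThreeTen
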